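import Mathlib.Analysis.SpecialFunctions.Pow.Real
import Mathlib.Tactic.FieldSimp
import Mathlib.Tactic.Ring
import Mathlib.Tactic.Linarith
import Mathlib.Tactic.Positivity
import Literature.Probability.RandomPlanarGeometry.SLEKappaRho
import HarnessLib

/-!
# [LSW] §8.4, Lemmas 8.9 and 8.10: the algebra of the one-sided martingale `M_t`

G. F. Lawler, O. Schramm, W. Werner, *Conformal restriction: the chordal case*, J. Amer. Math.
Soc. **16** (2003) 917–955, arXiv:math/0209343 (**[LSW]**), §8.4 "Proof of Theorem 8.4": "Fix
`ρ > −2` and let `c = 3ρ/8` and `b = ρ(4 + 3ρ)/32`. Let `(O_t, W_t)` generate an SLE(8/3, ρ)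
process so that `dW_t = ρ dt/(W_t − O_t) + √(8/3) dB_t`, `dO_t = 2 dt/(O_t − W_t)`. […]
`M_t := h_t'(W_t)^{5/8} h_t'(O_t)^b [(h_t(W_t) − h_t(O_t))/(W_t − O_t)]^c`."

This file PROVES the two finite computations on which Lemmas 8.9 and 8.10 rest, as identities
and inequalities between real numbers (no probability, no conformal maps):

* `SLEKappaRho.expB ρ = b`, `SLEKappaRho.expC ρ = c`, and `5/8 + b + c = α(ρ)`
  (`sleKappaRhoExponent`, the exponent of Thm. 8.4; [LSW] proof of Lemma 8.10: "Let
  `α = 5/8 + b + c = (3ρ + 10)(2 + ρ)/32` and note that `α > 0`"), with the signs of `b`, `c`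
  in the three ranges `ρ ≥ 0`, `ρ ∈ [−4/3, 0)`, `ρ ∈ (−2, −4/3)` of that proof.
* **Lemma 8.9, the omitted computation.** The printed proof: "Plugging the explicit choice of
  `(W_t, t ≥ 0)` into the results of §5 shows that for `t < T`,
  `d[h_t(W_t)] = (ρ h_t'(W_t)/(W_t − O_t) − (5/3) h_t''(W_t)) dt + √(8/3) h_t'(W_t) dB_t`,
  `d[h_t'(W_t)] = (ρ h_t''(W_t)/(W_t − O_t) + h_t''(W_t)²/(2h_t'(W_t))) dt + √(8/3) h_t''(W_t) dB_t`,
  `d[h_t(O_t)] = 2h_t'(W_t)² dt/(h_t(O_t) − h_t(W_t))`,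
  `d[h_t'(O_t)] = (2h_t'(O_t)/(O_t − W_t)² − 2h_t'(W_t)² h_t'(O_t)/(h_t(O_t) − h_t(W_t))²) dt`.
  Using these expressions in Itô's formula for `dM_t`, one can now compute the semi-martingale
  decomposition of `M_t`. This is tedious but straightforward, so we omit the detailed
  calculation here. The drift term of `dM_t` turns out to be `M_t` times
  `(5ρ/8 − 5c/3) h''(W)/(h'(W)(W − O)) + (2b − c(ρ+2) + (4/3)c(c+1))/(W − O)²
  + (−2b + 2c + (4/3)c(c−1)) h'(W)²/(h(W) − h(O))² + (−(8/3)c² + ρc) h'(W)/((W − O)(h(W) − h(O)))`.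
  The terms in `h''(W)²/h'(W)²` and in `h''(W)/(h(W) − h(O))` happen to vanish because of the
  choice of the exponent `5/8` (and `κ = 8/3`). The lemma follows as this drift term vanishes for
  the appropriate choice of `b` and `c`." Here `SLEKappaRho.itoDriftRatio` is the drift of
  `dM_t/M_t` that Itô's formula produces from the six displayed differentials (those of
  `h(W), h'(W), h(O), h'(O)` above and `dW`, `dO`) for `M = exp L`,
  `L = (5/8) log h'(W) + b log h'(O) + c log(h(W) − h(O)) − c log(W − O)`, namely
  `Σᵢ μᵢ ∂ᵢL + ½ Σᵢⱼ σᵢσⱼ (∂ᵢ∂ⱼL + ∂ᵢL ∂ⱼL)` written out term by term;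
  `SLEKappaRho.itoDriftRatio_eq` is the omitted "tedious but straightforward" computation (the
  result is the printed four-term expression: the `h''²/h'²` and `h''/(h(W) − h(O))` terms
  cancel), and `SLEKappaRho.driftCoeff_eq_zero` / `SLEKappaRho.itoDriftRatio_eq_zero` check
  that all four printed coefficients vanish at `b = ρ(4 + 3ρ)/32`, `c = 3ρ/8`.
* **Lemma 8.10, the quadratic form.** The printed proof (case `ρ ∈ (−2, −4/3)`): "But
  `o_s < w_s < x_s` for all `s ≤ S`. Hence (using the explicit values of `b` and `c`, and
  `ρ ∈ (−2, −4/3)`), `((5/8) − ε)/(x_s − w_s)² + c/((x_s − w_s)(x_s − o_s)) + b/(x_s − o_s)² ≥ 0`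
  for some positive `ε = ε(ρ)`." `SLEKappaRho.quadForm_ge`: for every `ρ ∈ (−2, 0)` and
  `0 ≤ Y ≤ X`, `(5/8) X² + c XY + b Y² ≥ α X²` (so `ε = α(ρ)` works: the parabola
  `5/8 + cu + bu²` decreases on `[0, 1]` to its value `α` at `u = 1`), and `SLEKappaRho.quadForm_le`:
  `(5/8) X² + c XY + b Y² ≤ (5/8) X²` there (used for the lower bound `M_t ≥ h_t'(W_t)`).

The analytic shells — Itô's formula for the random conformal maps `h_t` (Lemma 8.9 proper) and
the Loewner-chain representation (8.4) of `M_t` (Lemma 8.10 proper) — are in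
`SLEKappaRhoMartingale`.
-/

noncomputable section

namespace Literature.Probability.RandomPlanarGeometry

namespace SLEKappaRho

/-! ### The exponents `b`, `c` and `α = 5/8 + b + c` -/

/-- The exponent `b = ρ(4 + 3ρ)/32` of [LSW] §8.4 ("let `c = 3ρ/8` and `b = ρ(4 + 3ρ)/32`").
[cite: LawlerSchrammWerner2003Restriction, §8.4 (definition of b and c, before Lemma 8.9)] -/
def expB (ρ : ℝ) : ℝ := ρ * (4 + 3 * ρ) / 32

/-- The exponent `c = 3ρ/8` of [LSW] §8.4 ("let `c = 3ρ/8` and `b = ρ(4 + 3ρ)/32`").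
[cite: LawlerSchrammWerner2003Restriction, §8.4 (definition of b and c, before Lemma 8.9)] -/
def expC (ρ : ℝ) : ℝ := 3 * ρ / 8

/-- `α = 5/8 + b + c = (3ρ + 10)(2 + ρ)/32` ([LSW] proof of Lemma 8.10; `sleKappaRhoExponent`
is the exponent of Thm. 8.4). [cite: LawlerSchrammWerner2003Restriction, proof of Lemma 8.10 (α = 5/8 + b + c)] -/
theorem five_eighths_add_expB_add_expC (ρ : ℝ) :
    5 / 8 + expB ρ + expC ρ = sleKappaRhoExponent ρ := by
  simp only [expB, expC, sleKappaRhoExponent]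
  ring

/-- `c ≥ 0` for `ρ ≥ 0` ([LSW] proof of Lemma 8.10: "When `ρ ≥ 0`, the statement is trivial
since `b, c ≥ 0`"). [cite: LawlerSchrammWerner2003Restriction, proof of Lemma 8.10] -/
theorem expC_nonneg {ρ : ℝ} (h : 0 ≤ ρ) : 0 ≤ expC ρ := by
  simp only [expC]; positivity

/-- `b ≥ 0` for `ρ ≥ 0`. [cite: LawlerSchrammWerner2003Restriction, proof of Lemma 8.10] -/
theorem expB_nonneg {ρ : ℝ} (h : 0 ≤ ρ) : 0 ≤ expB ρ := by
  simp only [expB]; positivity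

/-- `c < 0` for `ρ < 0` ("One has to be a little bit careful when `ρ < 0` as `c < 0`").
[cite: LawlerSchrammWerner2003Restriction, proof of Lemma 8.10] -/
theorem expC_neg {ρ : ℝ} (h : ρ < 0) : expC ρ < 0 := by
  simp only [expC]; linarith

/-- `b ≤ 0` for `ρ ∈ [−4/3, 0]` ("in the case where `ρ ∈ [−4/3, 0)` (because then `b ≤ 0` and
`c ≤ 0`)"). [cite: LawlerSchrammWerner2003Restriction, proof of Lemma 8.10] -/
theorem expB_nonpos {ρ : ℝ} (h₁ : -4 / 3 ≤ ρ) (h₂ : ρ ≤ 0) : expB ρ ≤ 0 := by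
  simp only [expB]
  have : 0 ≤ 4 + 3 * ρ := by linarith
  have : ρ * (4 + 3 * ρ) ≤ 0 := mul_nonpos_of_nonpos_of_nonneg h₂ this
  linarith

/-- `b > 0` for `ρ < −4/3` ("Now suppose `ρ ∈ (−2, −4/3)`, which gives `c < 0` and `b > 0`").
[cite: LawlerSchrammWerner2003Restriction, proof of Lemma 8.10] -/
theorem expB_pos {ρ : ℝ} (h : ρ < -4 / 3) : 0 < expB ρ := by
  simp only [expB]
  have h1 : 4 + 3 * ρ < 0 := by linarith
  have h2 : ρ < 0 := by linarith
  have : 0 < ρ * (4 + 3 * ρ) := mul_pos_of_neg_of_neg h2 h1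
  linarith

/-- `c + 2b < 0` and `c + b < 0` for `ρ ∈ (−2, 0)`: the parabola `u ↦ 5/8 + cu + bu²` is
decreasing on `[0, 1]` (its vertex `−c/(2b)` lies beyond `1` when `b > 0`). [folklore] -/
theorem expC_add_two_mul_expB_neg {ρ : ℝ} (h₁ : -2 < ρ) (h₂ : ρ < 0) :
    expC ρ + 2 * expB ρ < 0 ∧ expC ρ + expB ρ < 0 := by
  simp only [expB, expC]
  constructor <;> nlinarith

/-! ### Lemma 8.9: the drift of `dM_t / M_t` -/

/-- The coefficient `5ρ/8 − 5c/3` of `h_t''(W_t)/(h_t'(W_t)(W_t − O_t))` in the printed drift of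
`dM_t/M_t`. [cite: LawlerSchrammWerner2003Restriction, proof of Lemma 8.9 (the drift term of dM_t)] -/
def driftCoeff₁ (ρ c : ℝ) : ℝ := 5 * ρ / 8 - 5 * c / 3

/-- The coefficient `2b − c(ρ + 2) + (4/3)c(c + 1)` of `1/(W_t − O_t)²` in the printed drift of
`dM_t/M_t`. [cite: LawlerSchrammWerner2003Restriction, proof of Lemma 8.9 (the drift term of dM_t)] -/
def driftCoeff₂ (ρ b c : ℝ) : ℝ := 2 * b - c * (ρ + 2) + 4 / 3 * c * (c + 1)

/-- The coefficient `−2b + 2c + (4/3)c(c − 1)` of `h_t'(W_t)²/(h_t(W_t) − h_t(O_t))²` in the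
printed drift of `dM_t/M_t`. [cite: LawlerSchrammWerner2003Restriction, proof of Lemma 8.9 (the drift term of dM_t)] -/
def driftCoeff₃ (b c : ℝ) : ℝ := -2 * b + 2 * c + 4 / 3 * c * (c - 1)

/-- The coefficient `−(8/3)c² + ρc` of `h_t'(W_t)/((W_t − O_t)(h_t(W_t) − h_t(O_t)))` in the
printed drift of `dM_t/M_t`. [cite: LawlerSchrammWerner2003Restriction, proof of Lemma 8.9 (the drift term of dM_t)] -/
def driftCoeff₄ (ρ c : ℝ) : ℝ := -(8 / 3) * c ^ 2 + ρ * c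

/-- **"The lemma follows as this drift term vanishes for the appropriate choice of `b` and
`c`"**: all four printed coefficients vanish at `b = ρ(4 + 3ρ)/32`, `c = 3ρ/8`.
[cite: LawlerSchrammWerner2003Restriction, proof of Lemma 8.9 (last sentence)] -/
theorem driftCoeff_eq_zero (ρ : ℝ) :
    driftCoeff₁ ρ (expC ρ) = 0 ∧ driftCoeff₂ ρ (expB ρ) (expC ρ) = 0 ∧
      driftCoeff₃ (expB ρ) (expC ρ) = 0 ∧ driftCoeff₄ ρ (expC ρ) = 0 := by
  simp only [driftCoeff₁, driftCoeff₂, driftCoeff₃, driftCoeff₄, expB, expC]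
  refine ⟨by ring, by ring, by ring, by ring⟩

/-- **The drift of `dM_t/M_t` by Itô's formula**, as a function of the free real quantities
`x₁ = h_t(W_t)`, `x₂ = h_t'(W_t)`, `x₅ = h_t''(W_t)`, `x₃ = h_t(O_t)`, `x₄ = h_t'(O_t)`,
`w = W_t`, `o = O_t`. With `M = exp L`, `L = (5/8) log x₂ + b log x₄ + c log(x₁ − x₃) − c log(w − o)`,
Itô's formula gives `dM_t/M_t = (Σᵢ μᵢ ∂ᵢL + ½ Σᵢⱼ σᵢσⱼ (∂ᵢ∂ⱼL + ∂ᵢL ∂ⱼL)) dt + (…) dB_t`, where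
the drifts `μ` and diffusion coefficients `σ = √(8/3)·s` of `(x₁, x₂, x₃, x₄, w, o)` are read off
the six displayed differentials of [LSW] (proof of Lemma 8.9 and the SLE(8/3, ρ) equations):
`μ₁ = ρx₂/(w − o) − (5/3)x₅`, `s₁ = x₂`; `μ₂ = ρx₅/(w − o) + x₅²/(2x₂)`, `s₂ = x₅`;
`μ₃ = 2x₂²/(x₃ − x₁)`; `μ₄ = 2x₄/(o − w)² − 2x₂²x₄/(x₃ − x₁)²`; `μ_w = ρ/(w − o)`, `s_w = 1`;
`μ_o = 2/(o − w)`; all other `s` vanish, and the mixed second derivatives of `L` in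
`(x₁, x₂, w)` vanish. This definition is that sum, term by term.
[cite: LawlerSchrammWerner2003Restriction, proof of Lemma 8.9 (Itô's formula for dM_t)] -/
def itoDriftRatio (ρ b c x₁ x₂ x₅ x₃ x₄ w o : ℝ) : ℝ :=
  -- drifts of `x₁ = h(W)`, `x₂ = h'(W)`, `x₃ = h(O)`, `x₄ = h'(O)`, `w = W`, `o = O`
  (ρ * x₂ / (w - o) - 5 / 3 * x₅) * (c / (x₁ - x₃)) +
  (ρ * x₅ / (w - o) + x₅ ^ 2 / (2 * x₂)) * (5 / (8 * x₂)) +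
  (2 * x₂ ^ 2 / (x₃ - x₁)) * (-c / (x₁ - x₃)) +
  (2 * x₄ / (o - w) ^ 2 - 2 * x₂ ^ 2 * x₄ / (x₃ - x₁) ^ 2) * (b / x₄) +
  (ρ / (w - o)) * (-c / (w - o)) +
  (2 / (o - w)) * (c / (w - o)) +
  -- Itô correction `½ · (8/3) · Σ sᵢ sⱼ (∂ᵢ∂ⱼL + ∂ᵢL ∂ⱼL)` over `(x₁, x₂, w)`
  (8 / 3) / 2 *
    (x₂ ^ 2 * (-c / (x₁ - x₃) ^ 2 + (c / (x₁ - x₃)) ^ 2) +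
      x₅ ^ 2 * (-5 / (8 * x₂ ^ 2) + (5 / (8 * x₂)) ^ 2) +
      1 * (c / (w - o) ^ 2 + (-c / (w - o)) ^ 2) +
      2 * x₂ * x₅ * (c / (x₁ - x₃) * (5 / (8 * x₂))) +
      2 * x₂ * 1 * (c / (x₁ - x₃) * (-c / (w - o))) +
      2 * x₅ * 1 * (5 / (8 * x₂) * (-c / (w - o))))

/-- **The omitted "tedious but straightforward" computation of the proof of Lemma 8.9**: the
drift of `dM_t/M_t` produced by Itô's formula IS the printed four-term expression
`(5ρ/8 − 5c/3) x₅/(x₂(w − o)) + (2b − c(ρ+2) + (4/3)c(c+1))/(w − o)²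
+ (−2b + 2c + (4/3)c(c−1)) x₂²/(x₁ − x₃)² + (−(8/3)c² + ρc) x₂/((w − o)(x₁ − x₃))` — the terms in
`x₅²/x₂²` (from `d[h'(W)]` and the Itô correction of `(5/8) log h'(W)`) and in `x₅/(x₁ − x₃)` (from
`d[h(W)]` and the cross-variation of `h(W)` and `h'(W)`) cancel, as stated in print, for every
`b`, `c` (the cancellation uses only the exponent `5/8` and `κ = 8/3`).
[cite: LawlerSchrammWerner2003Restriction, proof of Lemma 8.9 (the drift term of dM_t)] -/
theorem itoDriftRatio_eq {ρ b c x₁ x₂ x₅ x₃ x₄ w o : ℝ} (hx₂ : x₂ ≠ 0) (hx₄ : x₄ ≠ 0)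
    (hD : x₁ - x₃ ≠ 0) (hZ : w - o ≠ 0) :
    itoDriftRatio ρ b c x₁ x₂ x₅ x₃ x₄ w o =
      driftCoeff₁ ρ c * x₅ / (x₂ * (w - o)) + driftCoeff₂ ρ b c / (w - o) ^ 2 +
        driftCoeff₃ b c * x₂ ^ 2 / (x₁ - x₃) ^ 2 +
        driftCoeff₄ ρ c * x₂ / ((w - o) * (x₁ - x₃)) := by
  have hD' : x₃ - x₁ ≠ 0 := fun h ↦ hD (by linarith)
  have hZ' : o - w ≠ 0 := fun h ↦ hZ (by linarith)
  simp only [itoDriftRatio, driftCoeff₁, driftCoeff₂, driftCoeff₃, driftCoeff₄]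
  field_simp
  ring

/-- **Lemma 8.9, algebraic form: the drift of `dM_t/M_t` vanishes identically** for
`b = ρ(4 + 3ρ)/32`, `c = 3ρ/8` (whatever the values of `h, h', h''` at `W_t`, `O_t`).
[cite: LawlerSchrammWerner2003Restriction, Lemma 8.9 and its proof] -/
theorem itoDriftRatio_eq_zero {ρ x₁ x₂ x₅ x₃ x₄ w o : ℝ} (hx₂ : x₂ ≠ 0) (hx₄ : x₄ ≠ 0)
    (hD : x₁ - x₃ ≠ 0) (hZ : w - o ≠ 0) :
    itoDriftRatio ρ (expB ρ) (expC ρ) x₁ x₂ x₅ x₃ x₄ w o = 0 := by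
  obtain ⟨h1, h2, h3, h4⟩ := driftCoeff_eq_zero ρ
  rw [itoDriftRatio_eq hx₂ hx₄ hD hZ, h1, h2, h3, h4]
  simp

/-! ### Lemma 8.10: the quadratic form `(5/8) X² + c XY + b Y²` on `0 ≤ Y ≤ X` -/

/-- The factorisation behind the monotonicity of `u ↦ 5/8 + cu + bu²` on `[0, 1]`:
`(5/8) X² + c XY + b Y² − (5/8 + b + c) X² = (Y − X)(c X + b (X + Y))`. [folklore] -/
theorem quadForm_sub_eq (b c X Y : ℝ) :
    5 / 8 * X ^ 2 + c * X * Y + b * Y ^ 2 - (5 / 8 + b + c) * X ^ 2 =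
      (Y - X) * (c * X + b * (X + Y)) := by
  ring

/-- **The positivity of the proof of Lemma 8.10**, with the explicit `ε = α(ρ)`: for `ρ ∈ (−2, 0)`
and `0 ≤ Y ≤ X`, `(5/8) X² + c XY + b Y² ≥ α X²`, i.e.
`((5/8) − ε) X² + c XY + b Y² ≥ 0` with `ε = α = 5/8 + b + c > 0` (in print: "for some positive
`ε = ε(ρ)`", `X = 1/(x_s − w_s) > Y = 1/(x_s − o_s) > 0`). Proof: by `quadForm_sub_eq` the
difference is `(Y − X)(cX + b(X + Y)) ≥ 0`, as `Y ≤ X` and `cX + b(X + Y) ≤ max(c + 2b, c + b) X ≤ 0`.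
[cite: LawlerSchrammWerner2003Restriction, proof of Lemma 8.10 (case ρ ∈ (−2, −4/3))] -/
theorem quadForm_ge {ρ X Y : ℝ} (h₁ : -2 < ρ) (h₂ : ρ < 0) (hY : 0 ≤ Y) (hYX : Y ≤ X) :
    sleKappaRhoExponent ρ * X ^ 2 ≤ 5 / 8 * X ^ 2 + expC ρ * X * Y + expB ρ * Y ^ 2 := by
  rw [← five_eighths_add_expB_add_expC, ← sub_nonneg, quadForm_sub_eq]
  obtain ⟨hcb2, hcb⟩ := expC_add_two_mul_expB_neg h₁ h₂
  have hX : 0 ≤ X := hY.trans hYX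
  have hlin : expC ρ * X + expB ρ * (X + Y) ≤ 0 := by
    rcases le_or_gt 0 (expB ρ) with hb | hb
    · calc expC ρ * X + expB ρ * (X + Y) ≤ expC ρ * X + expB ρ * (X + X) := by
            gcongr
        _ = (expC ρ + 2 * expB ρ) * X := by ring
        _ ≤ 0 := mul_nonpos_of_nonpos_of_nonneg hcb2.le hX
    · calc expC ρ * X + expB ρ * (X + Y) ≤ expC ρ * X + expB ρ * X := by
            nlinarith
        _ = (expC ρ + expB ρ) * X := by ring
        _ ≤ 0 := mul_nonpos_of_nonpos_of_nonneg hcb.le hX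
  exact mul_nonneg_of_nonpos_of_nonpos (sub_nonpos.2 hYX) hlin

/-- The upper bound of the quadratic form on `0 ≤ Y ≤ X` for `ρ ∈ (−2, 0)`:
`(5/8) X² + c XY + b Y² ≤ (5/8) X²` (`cXY + bY² = Y(cX + bY) ≤ 0` as `cX + bY ≤ max(c, c + b) X ≤ 0`);
with (8.4) this gives `M_t ≥ h_t'(W_t)^{5/8}`. [folklore] -/
theorem quadForm_le {ρ X Y : ℝ} (h₁ : -2 < ρ) (h₂ : ρ < 0) (hY : 0 ≤ Y) (hYX : Y ≤ X) :
    5 / 8 * X ^ 2 + expC ρ * X * Y + expB ρ * Y ^ 2 ≤ 5 / 8 * X ^ 2 := by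
  obtain ⟨-, hcb⟩ := expC_add_two_mul_expB_neg h₁ h₂
  have hc : expC ρ < 0 := expC_neg h₂
  have hX : 0 ≤ X := hY.trans hYX
  have hlin : expC ρ * X + expB ρ * Y ≤ 0 := by
    rcases le_or_gt 0 (expB ρ) with hb | hb
    · calc expC ρ * X + expB ρ * Y ≤ expC ρ * X + expB ρ * X := by gcongr
        _ = (expC ρ + expB ρ) * X := by ring
        _ ≤ 0 := mul_nonpos_of_nonpos_of_nonneg hcb.le hX
    · have : expB ρ * Y ≤ 0 := mul_nonpos_of_nonpos_of_nonneg hb.le hY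
      have : expC ρ * X ≤ 0 := mul_nonpos_of_nonpos_of_nonneg hc.le hX
      linarith
  have : expC ρ * X * Y + expB ρ * Y ^ 2 = Y * (expC ρ * X + expB ρ * Y) := by ring
  nlinarith [mul_nonpos_of_nonneg_of_nonpos hY hlin]

end SLEKappaRho

end Literature.Probability.RandomPlanarGeometry

end
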